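import Summits.QuantumFields.YangMills.Theorems.UnitScaleTiltProp7AvgHessGaugeT2Letters
import Summits.QuantumFields.YangMills.Theorems.UnitScaleTiltProp7FrakGSupRowsOfWords
import HarnessLib

/-!
# Route `UnitScaleTilt`, crux K1 «MinimiserStabilityRegPr» (stmt-QuantumFields-19200), EX row `norm_G` (S47 ✓p766895), NORM_G ROAD (★p1 g27 CHAIR WORDs №24∕№25∕№28∕№31∕№33) —
# **(O-Qrow): THE SUP ROW OF `Q_k(U₀)` ON THE ROUTE CARRIERS AT A PRINTED-REGULAR BACKGROUND, AND THE 𝔊-ASSEMBLY DOOR WITH ITS (Qrow) LETTER DISCHARGED**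

Cell `ym3-torus` (HUMAN RULING D-0037; rung R3 = SU(2) YM₃ on T³ — NOT d = 4, NOT infinite volume, NOT a mass gap, NOT Clay).  Width seat `ym3-torus-px17` (gen 12).
THEOREMS ONLY (0 `def`, 0 `sorry`, default heartbeats); `--supports stmt-QuantumFields-19200 --as helper`; count-neutral.

THE POINT.  The 𝔊-assembly door ✓`Prop7FrakGSupRowsOfWords` (px17 g11) turns per-word sup letters into N1's two letters for `𝔊 = PᴾG₁ − H₁Q_kG₁`; one of its letters is the sup row
(Qrow) of print's averaging operator in A-units, `hQ : ∀ u s, (∀ b, ‖toL2⁻¹u b‖ ≤ s) → ∀ c, ‖toL2B⁻¹(Q_k(U₀)u) c‖ ≤ BQ·s`.  The supplier is px19 g14's ✓`Prop7AvgHessGaugeT2Letters.norm_QTwS_apply_le_of_regPr`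
((3.16) in the unscaled chart: `RegPr`, `10¹⁰L⁶ε₀ ≤ 1`, `10¹²L³ε₀ ≤ 1`, `‖Y b‖ ≤ s` ⟹ `‖QTwS U₀ Y c‖ ≤ 30·L^{K−n}·s`, for GENERAL `M₂(ℂ)`-valued `Y` — no sector split needed) read through
`Q_k = η•toL2B∘QTwS∘toL2⁻¹` (✓`Qk_toL2`) with `η·L^{K−n} = 1` (✓`eta_mul_pow_eq_one`): **`BQ := 30`, K-free and L-free**.  §2 re-issues the door's three E2E rows ON THE REGULAR CLASS with
`hQ` DISCHARGED (one letter fewer; every other binder token for token).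

WHAT IS PROVED (ns `Summit.QuantumFields.YangMills.Theorems.Prop7QkSupRowOfRegPr`; member `F`, `h : n ≤ K`, weights `c₀ cB`).
* §1 ★★ `norm_symm_Qk_toL2_apply_le_of_regPr` — `‖toL2B⁻¹(Q_k(U₀)(toL2 Y)) c‖ ≤ 30·s` for `‖Y b‖ ≤ s` (function currency); ★★ `supRow_Qk_of_regPr` — THE DOOR's `hQ` TEXT VERBATIM at `BQ := 30`
  (Hilbert-source currency `u`, `Y := toL2⁻¹u`); `norm_symm_Qk_le_of_regPr` — the sup-NORM form `‖toL2B⁻¹(Q_k u)‖ ≤ 30·s`.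
* §2 ★★ `value_row_frakGT_of_words_of_regPr` ∕ ★★ `gradient_row_frakGT_of_words_of_regPr` ∕ ★★★ `norm_frakGfR_le_of_words_of_regPr` — ✓p769750 §2∕§3∕§5 under `RegPr F n K ε₀ U₀` + the two
  windows, with `BQ = 30` and NO `hQ` binder: `M_V = BV₁ + C₂·BD₁ + 30·B_H·BV₁`, `M_∇ = BG₁ + M₃ + 30·B_H·BV₁`.
HYP-SAT (★★OWNER RULING №42).  `RegPr` is inhabited (EX's regular minimiser); the windows are the EX windows; the remaining letters are the door's (real-inequality schemas with named
suppliers: (V1)∕(Div1) ⟸ ✓`Prop7GreenOneSupRowsOfLetters`, (c2) ⟸ px5's (c)-package, (∇1) ⟸ N5∕(OF-GRAD), (Hess3) = STOREY H DISPLAY, `norm_H₁` = a displayed EX row); conclusions non-vacuous.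
HONEST SCOPE.  Bookkeeping: one scalar identity `η·L^{K−n} = 1` over a landed row; no estimate of print is proved here; nothing of the word letters, `norm_G`, `norm_H₁`, EX
`stub_existenceMinimalOrbit`, `MinimiserStabilityRegPr` (19200) or R3 is proved; the Yang–Mills mass gap is NOT proved.

References: T. Bałaban, CMP **99** (1985) 389–434 [Balaban1985BackgroundPropagators] ((3.13) p.392, (3.14)–(3.16) p.393, (3.152)–(3.153) p.426, Thm 3.13 p.426); CMP **102** (1985) 277–309
[Balaban1985Variational] ((44)–(45) p.285, (103) p.293, (110)–(111) p.294, (115)–(117) pp.294–295); CMP **95** (1984) 17–40 [Balaban1984PropagatorsI] ((1.18) p.20).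
-/

set_option autoImplicit false

noncomputable section

open scoped BigOperators Matrix.Norms.L2Operator

namespace Summit.QuantumFields.YangMills.Theorems.Prop7QkSupRowOfRegPr

open Literature.MathematicalPhysics.QuantumFieldTheory.Balaban1983to89
open Literature.MathematicalPhysics.QuantumFieldTheory.Balaban1983to89.T3ContinuumYM3Torus
open T3PrintedRegularMinimiser (RegPr)
open T3SectALandauChart (eta eta_pos)
open B9SectCLatticeCarrier (Bond)
open B9Eq311L2Pairing (WL2)
open B11Eq115Space (NegSize Space115)
open B11Eq111FrakG (nabla115)
open B11Eq103H1Complex (SiteL2K BondL2K)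
open Summit.QuantumFields.YangMills.Theorems.Prop7SectET3Transport (periodsT3 bondEquiv bgOfCfg)
open Summit.QuantumFields.YangMills.Theorems.Prop7SectET3HilbertLetters (W₂ toL2 toL2S toL2B DL2 DstarL2)
open Summit.QuantumFields.YangMills.Theorems.Prop7SectET3GaugeProjector (RS)
open Summit.QuantumFields.YangMills.Theorems.Prop7SectET3CurvedPropagators (Qk PosOnto GT HT H1f frakGT frakGfR)
open Summit.QuantumFields.YangMills.Theorems.Prop7SectET3DeltaPiPInv (GprimeP)
open Summit.QuantumFields.YangMills.Theorems.Prop7SectET3DeltaOnePInv (DeltaOneP)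
open Summit.QuantumFields.YangMills.Theorems.Prop7SymAvgTwSym (QTwS)
open Summit.QuantumFields.YangMills.Theorems.Prop7TransverseRowOfTubeRowRegPr (Qk_toL2)
open Summit.QuantumFields.YangMills.Theorems.Prop7BlockDistanceWeights (eta_mul_pow_eq_one)
open Summit.QuantumFields.YangMills.Theorems.Prop7AvgHessGaugeT2Letters (norm_QTwS_apply_le_of_regPr)
open Summit.QuantumFields.YangMills.Theorems.Prop7FrakGSupRowsOfWords (value_row_frakGT_of_words gradient_row_frakGT_of_words norm_frakGfR_le_of_words)

/-! ## §1 ★★ The sup row of `Q_k(U₀)` at a printed-regular background (`BQ = 30`) -/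

section Row

variable (F : T3Family) {n K : ℕ} (h : n ≤ K) (c₀ cB : ℝ)

/-- ★★ **THE SUP ROW OF `Q_k(U₀)` IN FUNCTION CURRENCY**: `RegPr F n K ε₀ U₀`, `10¹⁰L⁶ε₀ ≤ 1`, `10¹²L³ε₀ ≤ 1`, `‖Y b‖ ≤ s` for all fine bonds `b` ⟹ for every coarse bond `c`,
`‖toL2B⁻¹(Q_k(U₀)(toL2 Y)) c‖ ≤ 30·s` — ✓`norm_QTwS_apply_le_of_regPr` (`‖QTwS U₀ Y c‖ ≤ 30·L^{K−n}·s`) read through `Q_k = η•toL2B∘QTwS∘toL2⁻¹` with `η·L^{K−n} = 1`.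
[cite: Balaban1985BackgroundPropagators, (3.13) p.392, (3.14)–(3.16) p.393; Balaban1985Variational, (44)–(45) p.285; Balaban1984PropagatorsI, (1.18) p.20] -/
theorem norm_symm_Qk_toL2_apply_le_of_regPr {ε₀ : ℝ} (hε₀ : 0 < ε₀) (hε : 10 ^ 10 * (F.L : ℝ) ^ 6 * ε₀ ≤ 1) (hε12 : 10 ^ 12 * (F.L : ℝ) ^ 3 * ε₀ ≤ 1)
    (U₀ : GaugeField (F.P K) 0 (Matrix.specialUnitaryGroup (Fin 2) ℂ)) (hreg : RegPr F n K ε₀ U₀)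
    (Y : PBond (F.P K) 0 → Matrix (Fin 2) (Fin 2) ℂ) {s : ℝ} (hY : ∀ b, ‖Y b‖ ≤ s) (c : PBond (F.P n) 0) :
    ‖(toL2B F n cB).symm (Qk F n K h c₀ cB U₀ (toL2 F K c₀ Y)) c‖ ≤ 30 * s := by
  have hη : 0 < eta F n K := eta_pos F n K
  have hrow := norm_QTwS_apply_le_of_regPr F h hε₀ hε hε12 U₀ hreg Y hY c
  rw [Qk_toL2, LinearEquiv.map_smul, LinearEquiv.symm_apply_apply, Pi.smul_apply, norm_smul, Complex.norm_real,
    Real.norm_of_nonneg hη.le]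
  calc eta F n K * ‖QTwS F n K h U₀ Y c‖ ≤ eta F n K * (30 * (F.L : ℝ) ^ (K - n) * s) := mul_le_mul_of_nonneg_left hrow hη.le
    _ = 30 * (eta F n K * (F.L : ℝ) ^ (K - n)) * s := by ring
    _ = 30 * s := by rw [eta_mul_pow_eq_one F, mul_one]

/-- ★★ **(Qrow) = THE 𝔊-DOOR's `hQ` LETTER AT `BQ := 30`** (✓`Prop7FrakGSupRowsOfWords.value_row_frakGT_of_words`'s binder text, Hilbert-source currency): at a printed-regular
background in the two windows, `∀ u s, (∀ b, ‖toL2⁻¹u b‖ ≤ s) → ∀ c, ‖toL2B⁻¹(Q_k(U₀)u) c‖ ≤ 30·s` (§1 at `Y := toL2⁻¹u`).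
[cite: Balaban1985BackgroundPropagators, (3.16) p.393; Balaban1985Variational, (44)–(45) p.285] -/
theorem supRow_Qk_of_regPr {ε₀ : ℝ} (hε₀ : 0 < ε₀) (hε : 10 ^ 10 * (F.L : ℝ) ^ 6 * ε₀ ≤ 1) (hε12 : 10 ^ 12 * (F.L : ℝ) ^ 3 * ε₀ ≤ 1)
    (U₀ : GaugeField (F.P K) 0 (Matrix.specialUnitaryGroup (Fin 2) ℂ)) (hreg : RegPr F n K ε₀ U₀) :
    ∀ (u : BondL2K ℂ 3 (periodsT3 F K) c₀ W₂) (s : ℝ), (∀ b, ‖(toL2 F K c₀).symm u b‖ ≤ s) →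
      ∀ c, ‖(toL2B F n cB).symm (Qk F n K h c₀ cB U₀ u) c‖ ≤ 30 * s := by
  intro u s hu c
  have hrow := norm_symm_Qk_toL2_apply_le_of_regPr F h c₀ cB hε₀ hε hε12 U₀ hreg ((toL2 F K c₀).symm u) hu c
  rwa [LinearEquiv.apply_symm_apply] at hrow

/-- **THE SUP-NORM FORM**: `‖toL2B⁻¹(Q_k(U₀)u)‖ ≤ 30·s` whenever `‖toL2⁻¹u b‖ ≤ s` for all `b` (§1 at every coarse bond; `0 ≤ s` is forced by the hypothesis).
[cite: Balaban1985BackgroundPropagators, (3.16) p.393] -/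
theorem norm_symm_Qk_le_of_regPr {ε₀ : ℝ} (hε₀ : 0 < ε₀) (hε : 10 ^ 10 * (F.L : ℝ) ^ 6 * ε₀ ≤ 1) (hε12 : 10 ^ 12 * (F.L : ℝ) ^ 3 * ε₀ ≤ 1)
    (U₀ : GaugeField (F.P K) 0 (Matrix.specialUnitaryGroup (Fin 2) ℂ)) (hreg : RegPr F n K ε₀ U₀)
    (u : BondL2K ℂ 3 (periodsT3 F K) c₀ W₂) {s : ℝ} (hu : ∀ b, ‖(toL2 F K c₀).symm u b‖ ≤ s) :
    ‖(toL2B F n cB).symm (Qk F n K h c₀ cB U₀ u)‖ ≤ 30 * s := by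
  have hs : 0 ≤ s := (norm_nonneg _).trans (hu ⟨default, 0⟩)
  exact (pi_norm_le_iff_of_nonneg (by positivity)).2 fun c => supRow_Qk_of_regPr F h c₀ cB hε₀ hε hε12 U₀ hreg u s hu c

end Row

/-! ## §2 The 𝔊-assembly door on the regular class, (Qrow) discharged -/

section Door

variable (F : T3Family) (n K : ℕ) (h : n ≤ K) (c₀ cB a : ℝ) [Fact (0 < c₀)] [Fact (0 < cB)]
  (TJ : GaugeField (F.P K) 0 (Matrix.specialUnitaryGroup (Fin 2) ℂ) → (BondL2K ℂ 3 (periodsT3 F K) c₀ W₂ →ₗ[ℂ] BondL2K ℂ 3 (periodsT3 F K) c₀ W₂))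
  (U₀ : GaugeField (F.P K) 0 (Matrix.specialUnitaryGroup (Fin 2) ℂ))

/-- ★★ **(V) FOR `𝔊` FROM THE WORDS, ON THE REGULAR CLASS** — ✓`value_row_frakGT_of_words` with its (Qrow) letter DISCHARGED by §1 (`BQ = 30`):
`‖toL2⁻¹(𝔊(toL2 A)) b‖ ≤ (BV₁ + C₂·BD₁ + 30·B_H·BV₁)·‖A‖` from (V1)(Div1)(c2)(Hv) at `RegPr F n K ε₀ U₀` in the two windows.
[cite: Balaban1985BackgroundPropagators, (3.16) p.393, (3.119) p.419, (3.130)–(3.131) pp.421–422, (3.152)–(3.153) p.426; Balaban1985Variational, (103) p.293, (110)–(111) p.294] -/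
theorem value_row_frakGT_of_words_of_regPr {ε₀ : ℝ} (hε₀ : 0 < ε₀) (hε : 10 ^ 10 * (F.L : ℝ) ^ 6 * ε₀ ≤ 1) (hε12 : 10 ^ 12 * (F.L : ℝ) ^ 3 * ε₀ ≤ 1)
    (hreg : RegPr F n K ε₀ U₀) (ha : 0 ≤ a) (hp : PosOnto F n K h c₀ cB a (DeltaOneP F n K h c₀ cB a TJ) U₀)
    {BV₁ BD₁ C₂ BH : ℝ} (hBV₁ : 0 ≤ BV₁) (hBH : 0 ≤ BH)
    (hV1 : ∀ (A : PBond (F.P K) 0 → Matrix (Fin 2) (Fin 2) ℂ) (b : PBond (F.P K) 0),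
      ‖(toL2 F K c₀).symm (GT F n K h c₀ cB a (DeltaOneP F n K h c₀ cB a TJ) U₀ (toL2 F K c₀ A)) b‖ ≤ BV₁ * ‖A‖)
    (hD1 : ∀ (A : PBond (F.P K) 0 → Matrix (Fin 2) (Fin 2) ℂ) (x : Site (F.P K) 0),
      ‖(toL2S F K c₀).symm (DstarL2 F n K c₀ U₀ (GT F n K h c₀ cB a (DeltaOneP F n K h c₀ cB a TJ) U₀ (toL2 F K c₀ A))) x‖ ≤ BD₁ * ‖A‖)
    (hc2 : ∀ (v : Site (F.P K) 0 → Matrix (Fin 2) (Fin 2) ℂ) (m : ℝ), (∀ x, ‖v x‖ ≤ m) →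
      ∀ b, ‖(toL2 F K c₀).symm (DL2 F n K c₀ U₀ (GprimeP F n K h c₀ cB a U₀ (RS F n K h c₀ cB U₀ (toL2S F K c₀ v)))) b‖ ≤ C₂ * m)
    (hH : ∀ (Y : PBond (F.P n) 0 → Matrix (Fin 2) (Fin 2) ℂ) (b : PBond (F.P K) 0),
      ‖(toL2 F K c₀).symm (HT F n K h c₀ cB a (DeltaOneP F n K h c₀ cB a TJ) U₀ (toL2B F n cB Y)) b‖ ≤ BH * ‖Y‖)
    (A : PBond (F.P K) 0 → Matrix (Fin 2) (Fin 2) ℂ) (b : PBond (F.P K) 0) :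
    ‖(toL2 F K c₀).symm (frakGT F n K h c₀ cB a (DeltaOneP F n K h c₀ cB a TJ) U₀ (toL2 F K c₀ A)) b‖ ≤ (BV₁ + C₂ * BD₁ + BH * 30 * BV₁) * ‖A‖ :=
  value_row_frakGT_of_words F n K h c₀ cB a TJ U₀ ha hp hBV₁ hBH (by norm_num) hV1 hD1 hc2 hH
    (supRow_Qk_of_regPr F h c₀ cB hε₀ hε hε12 U₀ hreg) A b

/-- ★★ **(∇) FOR `𝔊` FROM THE WORDS, ON THE REGULAR CLASS** — ✓`gradient_row_frakGT_of_words` with its (Qrow) letter DISCHARGED by §1 (`BQ = 30`):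
`‖∇_{U₀}(toL2⁻¹(𝔊(toL2 A)) ∘ bondEquiv⁻¹)‖ ≤ (BG₁ + M₃ + 30·B_HG·BV₁)·‖A‖` from (V1)(∇1)(Hess3)(H∇) at `RegPr F n K ε₀ U₀` in the two windows.
[cite: Balaban1985BackgroundPropagators, (3.16) p.393, Thm 3.1 (3.42)–(3.45) pp.397–398, (3.152)–(3.153) p.426; Balaban1985Variational, (103) p.293, (115)–(117) pp.294–295] -/
theorem gradient_row_frakGT_of_words_of_regPr {ε₀ : ℝ} (hε₀ : 0 < ε₀) (hε : 10 ^ 10 * (F.L : ℝ) ^ 6 * ε₀ ≤ 1) (hε12 : 10 ^ 12 * (F.L : ℝ) ^ 3 * ε₀ ≤ 1)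
    (hreg : RegPr F n K ε₀ U₀) (ha : 0 ≤ a) (hp : PosOnto F n K h c₀ cB a (DeltaOneP F n K h c₀ cB a TJ) U₀)
    {BV₁ BG₁ M₃ BHG : ℝ} (hBV₁ : 0 ≤ BV₁) (hBHG : 0 ≤ BHG)
    (hV1 : ∀ (A : PBond (F.P K) 0 → Matrix (Fin 2) (Fin 2) ℂ) (b : PBond (F.P K) 0),
      ‖(toL2 F K c₀).symm (GT F n K h c₀ cB a (DeltaOneP F n K h c₀ cB a TJ) U₀ (toL2 F K c₀ A)) b‖ ≤ BV₁ * ‖A‖)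
    (hG1 : ∀ A : PBond (F.P K) 0 → Matrix (Fin 2) (Fin 2) ℂ,
      ‖nabla115 (((F.L : ℝ)⁻¹) ^ (K - n)) (bgOfCfg F K U₀)
          (fun q : Bond 3 (periodsT3 F K) => (toL2 F K c₀).symm (GT F n K h c₀ cB a (DeltaOneP F n K h c₀ cB a TJ) U₀ (toL2 F K c₀ A)) ((bondEquiv F K).symm q))‖ ≤ BG₁ * ‖A‖)
    (h3 : ∀ A : PBond (F.P K) 0 → Matrix (Fin 2) (Fin 2) ℂ,
      ‖nabla115 (((F.L : ℝ)⁻¹) ^ (K - n)) (bgOfCfg F K U₀)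
          (fun q : Bond 3 (periodsT3 F K) => (toL2 F K c₀).symm (DL2 F n K c₀ U₀ (GprimeP F n K h c₀ cB a U₀ (RS F n K h c₀ cB U₀
            (DstarL2 F n K c₀ U₀ (GT F n K h c₀ cB a (DeltaOneP F n K h c₀ cB a TJ) U₀ (toL2 F K c₀ A)))))) ((bondEquiv F K).symm q))‖ ≤ M₃ * ‖A‖)
    (hHG : ∀ Y : PBond (F.P n) 0 → Matrix (Fin 2) (Fin 2) ℂ,
      ‖nabla115 (((F.L : ℝ)⁻¹) ^ (K - n)) (bgOfCfg F K U₀)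
          (fun q : Bond 3 (periodsT3 F K) => (toL2 F K c₀).symm (HT F n K h c₀ cB a (DeltaOneP F n K h c₀ cB a TJ) U₀ (toL2B F n cB Y)) ((bondEquiv F K).symm q))‖ ≤ BHG * ‖Y‖)
    (A : PBond (F.P K) 0 → Matrix (Fin 2) (Fin 2) ℂ) :
    ‖nabla115 (((F.L : ℝ)⁻¹) ^ (K - n)) (bgOfCfg F K U₀)
        (fun q : Bond 3 (periodsT3 F K) =>
          (toL2 F K c₀).symm (frakGT F n K h c₀ cB a (DeltaOneP F n K h c₀ cB a TJ) U₀ (toL2 F K c₀ A)) ((bondEquiv F K).symm q))‖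
      ≤ (BG₁ + M₃ + BHG * 30 * BV₁) * ‖A‖ :=
  gradient_row_frakGT_of_words F n K h c₀ cB a TJ U₀ ha hp hBV₁ hBHG (by norm_num) hV1 hG1 h3 hHG
    (supRow_Qk_of_regPr F h c₀ cB hε₀ hε hε12 U₀ hreg) A

variable [Fact (0 < (F.L : ℝ))] [Fact (0 < ((F.L : ℝ)⁻¹) ^ (K - n))]

/-- ★★★ **`norm_G`'s INEQUALITY AT THE SLOT `Δ₁ = Pᴾ†(Δ^η + T_J)Pᴾ` ON THE REGULAR CLASS, (Qrow) DISCHARGED** — ✓`norm_frakGfR_le_of_words` with `BQ = 30` supplied by §1: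
`‖frakGfR … (DeltaOneP T_J) U₀ f‖ ≤ max M_V M_∇ · ‖f‖`, `M_V = BV₁ + C₂·BD₁ + 30·B_H·BV₁`, `M_∇ = BG₁ + M₃ + 30·B_H·BV₁`, from the word letters (V1)(Div1)(c2)(∇1)(Hess3) and the
`norm_H₁` text, at `RegPr F n K ε₀ U₀` in the two windows.
[cite: Balaban1985Variational, (117) p.295; Balaban1985BackgroundPropagators, (3.16) p.393, Thm 3.13 p.426, (3.130)–(3.131) pp.421–422, (3.152)–(3.153) p.426] -/
theorem norm_frakGfR_le_of_words_of_regPr {ε₀ : ℝ} (hε₀ : 0 < ε₀) (hε : 10 ^ 10 * (F.L : ℝ) ^ 6 * ε₀ ≤ 1) (hε12 : 10 ^ 12 * (F.L : ℝ) ^ 3 * ε₀ ≤ 1)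
    (hreg : RegPr F n K ε₀ U₀) (ha : 0 ≤ a) (hp : PosOnto F n K h c₀ cB a (DeltaOneP F n K h c₀ cB a TJ) U₀)
    {BV₁ BD₁ C₂ BH BG₁ M₃ : ℝ} (hBV₁ : 0 ≤ BV₁) (hBD₁ : 0 ≤ BD₁) (hC₂ : 0 ≤ C₂) (hBH : 0 ≤ BH)
    (hV1 : ∀ (A : PBond (F.P K) 0 → Matrix (Fin 2) (Fin 2) ℂ) (b : PBond (F.P K) 0),
      ‖(toL2 F K c₀).symm (GT F n K h c₀ cB a (DeltaOneP F n K h c₀ cB a TJ) U₀ (toL2 F K c₀ A)) b‖ ≤ BV₁ * ‖A‖)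
    (hD1 : ∀ (A : PBond (F.P K) 0 → Matrix (Fin 2) (Fin 2) ℂ) (x : Site (F.P K) 0),
      ‖(toL2S F K c₀).symm (DstarL2 F n K c₀ U₀ (GT F n K h c₀ cB a (DeltaOneP F n K h c₀ cB a TJ) U₀ (toL2 F K c₀ A))) x‖ ≤ BD₁ * ‖A‖)
    (hc2 : ∀ (v : Site (F.P K) 0 → Matrix (Fin 2) (Fin 2) ℂ) (m : ℝ), (∀ x, ‖v x‖ ≤ m) →
      ∀ b, ‖(toL2 F K c₀).symm (DL2 F n K c₀ U₀ (GprimeP F n K h c₀ cB a U₀ (RS F n K h c₀ cB U₀ (toL2S F K c₀ v)))) b‖ ≤ C₂ * m)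
    (hG1 : ∀ A : PBond (F.P K) 0 → Matrix (Fin 2) (Fin 2) ℂ,
      ‖nabla115 (((F.L : ℝ)⁻¹) ^ (K - n)) (bgOfCfg F K U₀)
          (fun q : Bond 3 (periodsT3 F K) => (toL2 F K c₀).symm (GT F n K h c₀ cB a (DeltaOneP F n K h c₀ cB a TJ) U₀ (toL2 F K c₀ A)) ((bondEquiv F K).symm q))‖ ≤ BG₁ * ‖A‖)
    (h3 : ∀ A : PBond (F.P K) 0 → Matrix (Fin 2) (Fin 2) ℂ,
      ‖nabla115 (((F.L : ℝ)⁻¹) ^ (K - n)) (bgOfCfg F K U₀)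
          (fun q : Bond 3 (periodsT3 F K) => (toL2 F K c₀).symm (DL2 F n K c₀ U₀ (GprimeP F n K h c₀ cB a U₀ (RS F n K h c₀ cB U₀
            (DstarL2 F n K c₀ U₀ (GT F n K h c₀ cB a (DeltaOneP F n K h c₀ cB a TJ) U₀ (toL2 F K c₀ A)))))) ((bondEquiv F K).symm q))‖ ≤ M₃ * ‖A‖)
    (hnormH : ∀ B : PBond (F.P n) 0 → Matrix (Fin 2) (Fin 2) ℂ, ‖H1f F n K h c₀ cB a (DeltaOneP F n K h c₀ cB a TJ) U₀ B‖ ≤ BH * ‖B‖)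
    (f : NegSize (F.L : ℝ) (((F.L : ℝ)⁻¹) ^ (K - n)) (fun _ : Bond 3 (periodsT3 F K) => K - n) 3 (Matrix (Fin 2) (Fin 2) ℂ)) :
    ‖frakGfR F n K h c₀ cB a (DeltaOneP F n K h c₀ cB a TJ) U₀ f‖ ≤ max (BV₁ + C₂ * BD₁ + BH * 30 * BV₁) (BG₁ + M₃ + BH * 30 * BV₁) * ‖f‖ :=
  norm_frakGfR_le_of_words F n K h c₀ cB a TJ U₀ ha hp hBV₁ hBD₁ hC₂ hBH (by norm_num) hV1 hD1 hc2
    (supRow_Qk_of_regPr F h c₀ cB hε₀ hε hε12 U₀ hreg) hG1 h3 hnormH f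

end Door

end Summit.QuantumFields.YangMills.Theorems.Prop7QkSupRowOfRegPr

end
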